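import Literature.AnabelianGeometry.EtaleTheta.Discharge.Sec3Prop34CnstOfRlfRChainModelNV
import Literature.AnabelianGeometry.EtaleTheta.Discharge.Sec3Prop34CnstOfRlfRChainModelConst
import Literature.AnabelianGeometry.EtaleTheta.Discharge.Sec3Thm37OfInputsOfProp34Const
import HarnessLib

/-!
# [EtTh] Theorem 3.7 (i)–(iv) OUTRIGHT at the `Ÿ`-type chain inhabitant: the `Λ = ℝ` END KNIT with every residual
# binder a THEOREM

S. Mochizuki, *The étale theta function …*, Publ. RIMS **45** (2009) [EtTh], Thm. 3.7 (i)–(iv), PDF pp. 79–80;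
Prop. 3.4 (ii) p. 74 [cite: MochizukiEtTh2009, Thm 3.7 p.79].  abc-iut cell, layer L2, node EtTh:Thm3.7 «END KNIT»,
sub-DAG `plan/L2/SUBDAG-EtTh-Thm37.md`; seat abc-iut-w6-d061 (gen 4).  PROOF-ONLY companion of
`Sec3Prop34CnstOfRlfRChainModelNV.lean` (this seat: the inhabitant `chainTemperedFrobenioidR R S` of
`TemperedFrobenioid (ofRlfR dm hpf) (Discrete PUnit) (treeCatVocab _ R S)` over abc-iut-w6-d046's `Ÿ`-type chain data)
and of abc-iut-w5-d164's END KNIT `TemperedFrobenioid.thm37_ofRlfR_of_inputs_of_prop34Const`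
(`Sec3Thm37OfInputsOfProp34Const.lean`, residual binders {`hBmon`, `hD`, `hnd`, `hrat`, `h₀`, `hE`, `hC`}).

HERE every residual binder of that END KNIT except `hrat` is DISCHARGED at the chain inhabitant: `hBmon` (one-object
base), `hD` (`Discrete PUnit` is of FSM-, hence FSMFF-type), `hnd` (pull-backs along identities), `h₀`
(`Prop34Cnst₀` over any `cnst` out of the one-object base — abc-iut-w6-d046's argument), `hE` (abc-iut-w6-d046's `eff`:
the discrete maximum principle), `hC` (abc-iut-w6-d046's `prop34Const`, p438436); `D^cnst := 𝓑(G)⁰` for the trivial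
compact group.  Result: `thm37_chainTemperedFrobenioidR_of_hrat` — Thm. 3.7 (i) (unit-trivial / isotropic / model /
birationally Frobenius-normalized / sub-quasi-Frobenius-trivial / not group-like), (ii) (standard ∧ rationally
standard), (iii) (first clause), (iv) at a Def. 3.6 (ii) datum with INFINITELY MANY primes, modulo print's own
rationality hypothesis `hrat` ([FrdI] Def. 4.5 (ii)) alone.  HONEST LABEL: a MODEL instance (consistency / joint
satisfiability of the END KNIT's residual list); nothing here bears on [IUTchIII] Cor. 3.12; typed ≠ proved.
-/

noncomputable section

namespace Literature.AnabelianGeometry.EtaleTheta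

open CategoryTheory Opposite Literature.AlgebraicGeometry.Frobenioids Literature.AnabelianGeometry.SemiGraphs

namespace Sec3Prop34CnstOfRlfRChainModel

variable (R S : ((Discrete PUnit.{1})ᵒᵖ ⥤ CommMonCat.{0}) → Prop)

/-- `D^cnst` for the chain model: the coset category `𝓑(G)⁰` of the TRIVIAL compact group, `cnst` the constant
functor at `G/G` (the one-object base has only identity morphisms). [cite: MochizukiEtTh2009, Thm 3.7 (iii) p.79] -/
def cnstChain : Discrete PUnit.{1} ⥤ CosetCat PUnit.{1} :=
  (Functor.const _).obj CosetCat.top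

/-- `Prop34Cnst₀` holds for the chain data over ANY `cnst` out of the one-object base (all morphisms are
identities; abc-iut-w6-d046's `prop34Cnst₀` is the case `cnst = 𝟭`). [cite: MochizukiEtTh2009, Prop 3.4 (ii) p.74] -/
theorem prop34Cnst₀_of_punit {Dc : Type} [Category.{0} Dc] (cnst : Discrete PUnit.{1} ⥤ Dc) : dm.Prop34Cnst₀ cnst where
  B₀_map_eq_of_cnst_map_eq g g' _ _ _ := by rw [Subsingleton.elim g g']
  Φ₀_map_eq_of_cnst_map_eq g g' _ _ _ := by rw [Subsingleton.elim g g']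
  cnst_map_eq_of_B₀_map_eq g g' _ := by rw [Subsingleton.elim g.hom g'.hom]

/-- `hBmon`: the rational-function monoid `B` of the chain inhabitant is a monoid on the one-object base.
[cite: MochizukiFrdI2008, Thm. 5.2 p.100] -/
theorem isMonoidOn_ratFnFunctor_chain : IsMonoidOn (chainTemperedFrobenioidR R S).ratFnFunctor :=
  Cor38Toy.isMonoidOn_of_punit _

/-- `hnd`: `Φ` of the chain inhabitant is non-dilating (the only endomorphisms of the base are identities, whose
pull-backs are identities). [cite: MochizukiEtTh2009, Thm 3.7 (ii) p.79] -/
theorem isNonDilatingOn_chain : IsNonDilatingOn (chainTemperedFrobenioidR R S).divisorMonoid := by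
  rw [(chainTemperedFrobenioidR R S).isNonDilatingOn_divisorMonoid_iff]
  intro A f
  have hf : f = 𝟙 A := Quiver.Hom.unop_inj (Subsingleton.elim _ _)
  subst hf
  have hpull : (chainTemperedFrobenioidR R S).Φ.pull (𝟙 A) = MonoidHom.id _ := by
    ext x
    rw [SubMonoidOn.coe_pull, CategoryTheory.Functor.map_id, MonoidHom.id_apply]
    rfl
  rw [hpull]
  exact Example39NV.isNonDilating_id

/-- **[EtTh] Theorem 3.7 (i)–(iv) at the `Ÿ`-type chain inhabitant, modulo print's rationality hypothesis `hrat`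
ONLY** — abc-iut-w5-d164's `Λ = ℝ` END KNIT `thm37_ofRlfR_of_inputs_of_prop34Const` with `hBmon`, `hD`, `hnd`, `h₀`,
`hE` (= abc-iut-w6-d046's `eff`), `hC` (= abc-iut-w6-d046's `prop34Const`) all THEOREMS here, `D^cnst = 𝓑(1)⁰`.
[cite: MochizukiEtTh2009, Thm 3.7 p.79] -/
theorem thm37_chainTemperedFrobenioidR_of_hrat
    (hrat : ∀ X : (chainTemperedFrobenioidR R S).category,
      PreFrobenioidData.IsRational
        (PreFrobenioid.biratData
          ((chainTemperedFrobenioidR R S).isFrobenioid_treeCatVocab_of_isMonoidOn (isMonoidOn_ratFnFunctor_chain R S))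
          (PreFrobenioid.hasBiratSquares_of_isFrobenioid
            ((chainTemperedFrobenioidR R S).isFrobenioid_treeCatVocab_of_isMonoidOn (isMonoidOn_ratFnFunctor_chain R S))))
        (S := PreFrobenioidData.ofFunctor (chainTemperedFrobenioidR R S).divisorMonoid (chainTemperedFrobenioidR R S).toElem)
        (fun a 𝔭 => PrimarySupp a 𝔭) X) :
    (PreFrobenioid.IsOfType (PreFrobenioid.IsUnitTrivial (chainTemperedFrobenioidR R S).toElem) ∧
      PreFrobenioid.IsOfIsotropicType (chainTemperedFrobenioidR R S).toElem ∧
      PreFrobenioid.IsOfModelType (chainTemperedFrobenioidR R S).toElem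
        ((chainTemperedFrobenioidR R S).isFrobenioid_treeCatVocab_of_isMonoidOn (isMonoidOn_ratFnFunctor_chain R S))
        (PreFrobenioid.hasBiratSquares_of_isFrobenioid
          ((chainTemperedFrobenioidR R S).isFrobenioid_treeCatVocab_of_isMonoidOn (isMonoidOn_ratFnFunctor_chain R S))) ∧
      PreFrobenioidData.IsOfBiratFrobeniusNormalizedType
        (PreFrobenioid.biratData
          ((chainTemperedFrobenioidR R S).isFrobenioid_treeCatVocab_of_isMonoidOn (isMonoidOn_ratFnFunctor_chain R S))
          (PreFrobenioid.hasBiratSquares_of_isFrobenioid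
            ((chainTemperedFrobenioidR R S).isFrobenioid_treeCatVocab_of_isMonoidOn (isMonoidOn_ratFnFunctor_chain R S)))) ∧
      PreFrobenioid.IsOfType (PreFrobenioid.IsSubQuasiFrobeniusTrivial (chainTemperedFrobenioidR R S).toElem) ∧
      ¬ PreFrobenioid.IsOfType (PreFrobenioid.IsGroupLikeObj (chainTemperedFrobenioidR R S).toElem)) ∧
    ((ModelFrobenioid.data (chainTemperedFrobenioidR R S).divisorMonoid (chainTemperedFrobenioidR R S).ratFnFunctor
        (chainTemperedFrobenioidR R S).divBNatTrans).IsOfStandardType ∧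
      (PreFrobenioidData.ofFunctor (chainTemperedFrobenioidR R S).divisorMonoid
          (chainTemperedFrobenioidR R S).toElem).IsOfRationallyStandardType
        (PreFrobenioid.rsParams
          ((chainTemperedFrobenioidR R S).isFrobenioid_treeCatVocab_of_isMonoidOn (isMonoidOn_ratFnFunctor_chain R S))
          fun a 𝔭 => PrimarySupp a 𝔭)) ∧
    (∀ A : (chainTemperedFrobenioidR R S).category,
      FrobenioidFacade.AutActionFactorsThrough ((chainTemperedFrobenioidR R S).base ⋙ cnstChain)
        (chainTemperedFrobenioidR R S).toElem A) ∧
    (chainTemperedFrobenioidR R S).Thm37_iv :=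
  (chainTemperedFrobenioidR R S).thm37_ofRlfR_of_inputs_of_prop34Const (cnst := cnstChain)
    (isMonoidOn_ratFnFunctor_chain R S) PadicFrd.isOfFSMType_discretePUnit.isOfFSMFFType (isNonDilatingOn_chain R S) hrat
    (prop34Cnst₀_of_punit cnstChain) (fun Y b x hb hbx => eff Y b x hb hbx) prop34Const


/-! ### Discharging `hrat` ([FrdI] Def. 4.5 (ii)) at the chain inhabitant: every object is STRICTLY RATIONAL -/

/-- `PrimarySupp` is invariant under isomorphisms of monoids (primary elements, their classes and `≼` are
transported). [cite: MochizukiFrdI2008, §0 p.12] -/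
theorem primarySupp_map_iff {N N' : Type} [CommMonoid N] [CommMonoid N'] (e : N ≃* N') (a : N) (𝔭 : Primes N) :
    PrimarySupp (e a) (Primes.congr e 𝔭) ↔ PrimarySupp a 𝔭 := by
  constructor
  · rintro ⟨a₀, h₀, hq, hle⟩
    refine ⟨e.symm a₀, h₀.map_mulEquiv e.symm, ?_, ?_⟩
    · have h1 := congrArg (Primes.congr e.symm) hq
      rw [Primes.congr_symm_apply_congr] at h1
      rw [← h1]
      exact (Primes.congr_mk e.symm a₀ h₀ _).symm
    · have h2 : e.symm a₀ ≼ e.symm (e a) := (precsim_map_iff e.symm).mpr hle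
      rwa [MulEquiv.symm_apply_apply] at h2
  · rintro ⟨a₀, h₀, rfl, hle⟩
    exact ⟨e a₀, h₀.map_mulEquiv e, (Primes.congr_mk e a₀ h₀ _).symm, (precsim_map_iff e).mpr hle⟩

/-- In `Φ₀ = ∏_{ℤ⊔ℤ} ℚ_{≥0}`: `𝔭 ∈ Supp(a)` iff `a` is nonzero at the index of `𝔭`. [cite: MochizukiFrdI2008, §0 p.12] -/
theorem primarySupp_iff_mem_dsupp (a : M) (𝔭 : Primes M) :
    PrimarySupp a 𝔭 ↔ PiMonoprime.idx PiNNRat.hP 𝔭 ∈ dsupp a := by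
  classical
  constructor
  · rintro ⟨a₀, h₀, hq, hle⟩
    have hmem : a₀ ∈ 𝔭.carrier := ⟨h₀, hq⟩
    rw [PiMonoprime.mem_carrier_iff PiNNRat.hP] at hmem
    have hsub := PiMonoprime.dsupp_subset_of_precsim
      (fun i => MonoprimeStructure.isSharp (PiNNRat.hP (ι := I) i)) hle
    rw [hmem, Set.singleton_subset_iff] at hsub
    exact hsub
  · intro hi
    refine ⟨Pi.mulSingle (PiMonoprime.idx PiNNRat.hP 𝔭) (DirectSum.gen PiNNRat.hP (PiMonoprime.idx PiNNRat.hP 𝔭)),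
      PiMonoprime.isPrimary_mulSingle_gen PiNNRat.hP _, ?_, PiMonoprime.mulSingle_precsim_of_mem_dsupp PiNNRat.hP hi _⟩
    exact PiMonoprime.primeOf_idx PiNNRat.hP 𝔭

/-- `Φ₀ = ∏_{ℤ⊔ℤ} ℚ_{≥0} ≅ Φ(Y)`, `m ↦ ι(m)`. [cite: MochizukiEtTh2009, Def 3.6 p.76] -/
def eΦ (Y : (Discrete PUnit.{1})ᵒᵖ) : M ≃* ↥(chainΦcarrier Y) :=
  (PiNNRat.eM (ι := I)).trans
    (MulEquiv.ofBijective _ (Example39NV.mrangeRestrict_toRealification_bijective (hpf Y)))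

/-- `(eΦ m).1 = ι(m)`. [cite: MochizukiEtTh2009, Def 3.6 p.76] -/
theorem coe_eΦ (Y : (Discrete PUnit.{1})ᵒᵖ) (m : M) :
    ((eΦ Y m : ↥(chainΦcarrier Y)) : realifiedChainR.ΦR.obj Y) =
      (hpf Y).toRealification (AlgebraicGeometry.Frobenioids.Perfection.of _ m) := rfl

/-! #### The rational function `U_j` (component orders `δ_j`): divisor `C_j + 2·x_j − x_{j−1} − x_{j+1}` -/

/-- The component-order function `δ_j` (the coordinate function vanishing to order one exactly on `C_j`).
[cite: MochizukiEtTh2009, Def 3.3 p.73] -/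
def delta (j : ℤ) : ℤ → ℤ := Pi.single j 1

/-- `div(U_j)` at the component `C_j` is `1`. [cite: MochizukiEtTh2009, Def 3.3 p.73] -/
theorem D_delta_inl (j : ℤ) : D (delta j) (Sum.inl j) = 1 := by
  simp [delta, D_inl]

/-- `div(U_j)` at the cusp `x_j` is `2` (law (L): `−Δ²δ_j(j) = 2`). [cite: MochizukiEtTh2009, Def 3.3 p.73] -/
theorem D_delta_inr (j : ℤ) : D (delta j) (Sum.inr j) = 2 := by
  have h1 : j + 1 ≠ j := by omega
  have h2 : j - 1 ≠ j := by omega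
  simp [delta, D_inr, lap, h1, h2]

/-- The positive part `div(U_j)⁺ ∈ Φ₀` is nonzero at the component `C_j` and at the cusp `x_j`.
[cite: MochizukiEtTh2009, Def 3.3 p.73] -/
theorem posPart_D_delta_ne_one (j : ℤ) (i : I) (hi : i = Sum.inl j ∨ i = Sum.inr j) :
    PiNNRat.posPart (D (delta j)) i ≠ 1 := by
  change Multiplicative.ofAdd (((D (delta j) i).toNat : ℚ≥0)) ≠ 1
  rcases hi with rfl | rfl
  · rw [D_delta_inl]; simp
  · rw [D_delta_inr]; simp

/-- The negative part `div(U_j)⁻ ∈ Φ₀` vanishes at the component `C_j` and at the cusp `x_j`.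
[cite: MochizukiEtTh2009, Def 3.3 p.73] -/
theorem negPart_D_delta_eq_one (j : ℤ) (i : I) (hi : i = Sum.inl j ∨ i = Sum.inr j) :
    PiNNRat.negPart (D (delta j)) i = 1 := by
  change Multiplicative.ofAdd (((-D (delta j) i).toNat : ℚ≥0)) = 1
  rcases hi with rfl | rfl
  · rw [D_delta_inl]; simp
  · rw [D_delta_inr]; simp


/-- The `B₀^ℝ`-component `ι(div₀ U_j) ∈ ℝ·Φ₀^birat(Y)` of the rational function `U_j`. [cite: MochizukiEtTh2009, Def 3.6 p.76] -/
def fnDelta (Y : (Discrete PUnit.{1})ᵒᵖ) (j : ℤ) : realifiedChainR.BΛ.obj Y :=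
  ⟨EtaleTheta.gpMap (realifiedChainR.toR Y) (dm.div₀ Y (Multiplicative.ofAdd (delta j))), by
    have h := (RealifiedDivisorMonoids.realData dm hpf).toRlfGp_mem_realSpan dm.biratGp (unop Y)
      (c := dm.div₀ Y (Multiplicative.ofAdd (delta j))) (Subgroup.subset_closure ⟨Multiplicative.ofAdd (delta j), rfl⟩)
    rw [RealifiedDivisorMonoids.toRlfGp_realData_eq] at h
    exact h⟩

/-- `ι` on groupifications sends the integer divisor `[d⁺]/[d⁻]` to `[ι d⁺]/[ι d⁻]` (home types).
[cite: MochizukiEtTh2009, Def 3.6 p.76] -/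
theorem gpMap_toR_toGp (A : (Discrete PUnit.{1})ᵒᵖ) (d : I → ℤ) :
    EtaleTheta.gpMap (M := M) (N := (hpf A).Rlf)
        ((hpf A).toRealification.comp (AlgebraicGeometry.Frobenioids.Perfection.of M)) (PiNNRat.toGp d) =
      Algebra.GrothendieckGroup.of ((hpf A).toRealification
          (AlgebraicGeometry.Frobenioids.Perfection.of M (PiNNRat.posPart d))) /
        Algebra.GrothendieckGroup.of ((hpf A).toRealification
          (AlgebraicGeometry.Frobenioids.Perfection.of M (PiNNRat.negPart d))) := by
  rw [PiNNRat.toGp, map_div, EtaleTheta.gpMap_of, EtaleTheta.gpMap_of]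
  rfl

/-- `Φ(A)^gp → (Φ^{ℝ-log})^gp(A)` on a quotient of classes (home types). [cite: MochizukiEtTh2009, Def 3.6 p.77] -/
theorem gpMap_subtype_div_of (A : (Discrete PUnit.{1})ᵒᵖ) (x y : ↥(chainΦcarrier A)) :
    EtaleTheta.gpMap (N := (hpf A).Rlf) (chainΦcarrier A).subtype
        (Algebra.GrothendieckGroup.of x / Algebra.GrothendieckGroup.of y) =
      Algebra.GrothendieckGroup.of (x.1 : (hpf A).Rlf) / Algebra.GrothendieckGroup.of (y.1 : (hpf A).Rlf) := by
  rw [map_div, EtaleTheta.gpMap_of, EtaleTheta.gpMap_of]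
  rfl

/-- The compatibility `ι(div₀ U_j) = ι[div(U_j)⁺] − ι[div(U_j)⁻]` in `(Φ^{ℝ-log})^gp` defining the pair `U_j ∈ B(A)`.
[cite: MochizukiEtTh2009, Def 3.6 p.77] -/
theorem fnDelta_compat (A : (Discrete PUnit.{1})ᵒᵖ) (j : ℤ) :
    EtaleTheta.gpMap (M := M) (N := (hpf A).Rlf)
        ((hpf A).toRealification.comp (AlgebraicGeometry.Frobenioids.Perfection.of M))
        (divH (Multiplicative.ofAdd (delta j))) =
      EtaleTheta.gpMap (N := (hpf A).Rlf) (chainΦcarrier A).subtype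
        (Algebra.GrothendieckGroup.of (eΦ A (PiNNRat.posPart (D (delta j)))) /
          Algebra.GrothendieckGroup.of (eΦ A (PiNNRat.negPart (D (delta j))))) := by
  rw [divH_apply, toAdd_ofAdd, gpMap_toR_toGp, gpMap_subtype_div_of]
  rfl

/-- **The rational function `U_j ∈ B(A) = B₀^ℝ|_D ×_{(Φ^{ℝ-log})^gp} Φ^gp`** of the chain inhabitant at an object over
`A`: the pair `(ι(div₀ U_j), [div(U_j)⁺] − [div(U_j)⁻])`. [cite: MochizukiEtTh2009, Def 3.6 p.77] -/
def ratFnDelta (A : (Discrete PUnit.{1})ᵒᵖ) (j : ℤ) : ↥((chainTemperedFrobenioidR R S).ratFn A) :=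
  ⟨(fnDelta A j,
    Algebra.GrothendieckGroup.of (eΦ A (PiNNRat.posPart (D (delta j)))) /
      Algebra.GrothendieckGroup.of (eΦ A (PiNNRat.negPart (D (delta j))))),
    fnDelta_compat A j⟩

/-- `B` of the chain inhabitant is group-like (`B₀^ℝ` is a group). [cite: MochizukiFrdI2008, Thm. 5.2 p.100] -/
theorem isGroupLike_ratFnFunctor_chain :
    Objectwise (fun M _ => IsGroupLike M) (chainTemperedFrobenioidR R S).ratFnFunctor :=
  (chainTemperedFrobenioidR R S).isGroupLike_ratFnFunctor realifiedChainR.isUnit_BΛ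

/-- `Φ` of the chain inhabitant is objectwise divisorial. [cite: MochizukiFrdI2008, Def. 1.1 p.19] -/
theorem isDivisorial_divisorMonoid_chain :
    Objectwise (fun M _ => IsDivisorial M) (chainTemperedFrobenioidR R S).divisorMonoid :=
  fun A => (isPerfFactorial_chainΦcarrier (op A)).isDivisorial

/-- **`hrat`, strictly: every object of the chain inhabitant is STRICTLY RATIONAL** ([FrdI] Def. 4.5 (ii)) w.r.t. THE
birationalization and the primary support: for the prime `𝔭` of index `C_j` or `x_j`, the rational function `U_j`
has divisor `[div(U_j)⁺] − [div(U_j)⁻]` with `𝔭 ∈ Supp(div(U_j)⁺)` (order `1` at `C_j`, `2` at `x_j`) and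
`𝔭 ∉ Supp(div(U_j)⁻)` (supported at `x_{j±1}` only). [cite: MochizukiFrdI2008, Def. 4.5 (ii) p.86] -/
theorem isStrictlyRational_chain (A : (chainTemperedFrobenioidR R S).category) :
    PreFrobenioidData.IsStrictlyRational
      (PreFrobenioid.biratData
        ((chainTemperedFrobenioidR R S).isFrobenioid_treeCatVocab_of_isMonoidOn (isMonoidOn_ratFnFunctor_chain R S))
        (PreFrobenioid.hasBiratSquares_of_isFrobenioid
          ((chainTemperedFrobenioidR R S).isFrobenioid_treeCatVocab_of_isMonoidOn (isMonoidOn_ratFnFunctor_chain R S))))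
      (S := PreFrobenioidData.ofFunctor (chainTemperedFrobenioidR R S).divisorMonoid (chainTemperedFrobenioidR R S).toElem)
      (fun a 𝔭 => PrimarySupp a 𝔭) A := by
  classical
  refine (ModelFrobenioid.isStrictlyRational_biratData_iff (isGroupLike_ratFnFunctor_chain R S)
    (isDivisorial_divisorMonoid_chain R S) _ _ _ A).mpr fun 𝔭 => ?_
  -- the index of `𝔭` and its `ℤ`-coordinate
  obtain ⟨j, hj⟩ : ∃ j : ℤ, PiMonoprime.idx PiNNRat.hP (Primes.congr (eΦ (op A.base)).symm 𝔭) = Sum.inl j ∨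
      PiMonoprime.idx PiNNRat.hP (Primes.congr (eΦ (op A.base)).symm 𝔭) = Sum.inr j := by
    rcases PiMonoprime.idx PiNNRat.hP (Primes.congr (eΦ (op A.base)).symm 𝔭) with j | j
    · exact ⟨j, Or.inl rfl⟩
    · exact ⟨j, Or.inr rfl⟩
  have h𝔭 : 𝔭 = Primes.congr (eΦ (op A.base)) (Primes.congr (eΦ (op A.base)).symm 𝔭) :=
    (Primes.congr_apply_congr_symm (eΦ (op A.base)) 𝔭).symm
  refine ⟨eΦ (op A.base) (PiNNRat.posPart (D (delta j))), eΦ (op A.base) (PiNNRat.negPart (D (delta j))),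
    ⟨ratFnDelta R S (op A.base) j, rfl⟩, ?_, ?_⟩
  · rw [h𝔭]
    exact (primarySupp_map_iff _ _ _).mpr ((primarySupp_iff_mem_dsupp _ _).mpr (posPart_D_delta_ne_one j _ hj))
  · rw [h𝔭]
    exact fun h => (primarySupp_iff_mem_dsupp _ _).mp ((primarySupp_map_iff _ _ _).mp h)
      (negPart_D_delta_eq_one j _ hj)

/-- **`hrat`: every object of the chain inhabitant is RATIONAL** ([FrdI] Def. 4.5 (ii); strictly rational ⇒ rational).
[cite: MochizukiFrdI2008, Def. 4.5 (ii) p.86] -/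
theorem isRational_chain (A : (chainTemperedFrobenioidR R S).category) :
    PreFrobenioidData.IsRational
      (PreFrobenioid.biratData
        ((chainTemperedFrobenioidR R S).isFrobenioid_treeCatVocab_of_isMonoidOn (isMonoidOn_ratFnFunctor_chain R S))
        (PreFrobenioid.hasBiratSquares_of_isFrobenioid
          ((chainTemperedFrobenioidR R S).isFrobenioid_treeCatVocab_of_isMonoidOn (isMonoidOn_ratFnFunctor_chain R S))))
      (S := PreFrobenioidData.ofFunctor (chainTemperedFrobenioidR R S).divisorMonoid (chainTemperedFrobenioidR R S).toElem)
      (fun a 𝔭 => PrimarySupp a 𝔭) A :=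
  ModelFrobenioid.isRational_of_isStrictlyRational _ _ _ A (isStrictlyRational_chain R S A)

/-- **[EtTh] Theorem 3.7 (i)–(iv) OUTRIGHT at the `Ÿ`-type chain inhabitant — NO residual binder**: (i) unit-trivial /
isotropic / model / birationally Frobenius-normalized / sub-quasi-Frobenius-trivial / not group-like; (ii) standard ∧
rationally standard; (iii) first clause over `D^cnst = 𝓑(1)⁰`; (iv).  Every binder of abc-iut-w5-d164's `Λ = ℝ` END
KNIT is a theorem here, including print's rationality hypothesis (`isRational_chain`). [cite: MochizukiEtTh2009, Thm 3.7 p.79] -/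
theorem thm37_chainTemperedFrobenioidR :
    (PreFrobenioid.IsOfType (PreFrobenioid.IsUnitTrivial (chainTemperedFrobenioidR R S).toElem) ∧
      PreFrobenioid.IsOfIsotropicType (chainTemperedFrobenioidR R S).toElem ∧
      PreFrobenioid.IsOfModelType (chainTemperedFrobenioidR R S).toElem
        ((chainTemperedFrobenioidR R S).isFrobenioid_treeCatVocab_of_isMonoidOn (isMonoidOn_ratFnFunctor_chain R S))
        (PreFrobenioid.hasBiratSquares_of_isFrobenioid
          ((chainTemperedFrobenioidR R S).isFrobenioid_treeCatVocab_of_isMonoidOn (isMonoidOn_ratFnFunctor_chain R S))) ∧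
      PreFrobenioidData.IsOfBiratFrobeniusNormalizedType
        (PreFrobenioid.biratData
          ((chainTemperedFrobenioidR R S).isFrobenioid_treeCatVocab_of_isMonoidOn (isMonoidOn_ratFnFunctor_chain R S))
          (PreFrobenioid.hasBiratSquares_of_isFrobenioid
            ((chainTemperedFrobenioidR R S).isFrobenioid_treeCatVocab_of_isMonoidOn (isMonoidOn_ratFnFunctor_chain R S)))) ∧
      PreFrobenioid.IsOfType (PreFrobenioid.IsSubQuasiFrobeniusTrivial (chainTemperedFrobenioidR R S).toElem) ∧
      ¬ PreFrobenioid.IsOfType (PreFrobenioid.IsGroupLikeObj (chainTemperedFrobenioidR R S).toElem)) ∧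
    ((ModelFrobenioid.data (chainTemperedFrobenioidR R S).divisorMonoid (chainTemperedFrobenioidR R S).ratFnFunctor
        (chainTemperedFrobenioidR R S).divBNatTrans).IsOfStandardType ∧
      (PreFrobenioidData.ofFunctor (chainTemperedFrobenioidR R S).divisorMonoid
          (chainTemperedFrobenioidR R S).toElem).IsOfRationallyStandardType
        (PreFrobenioid.rsParams
          ((chainTemperedFrobenioidR R S).isFrobenioid_treeCatVocab_of_isMonoidOn (isMonoidOn_ratFnFunctor_chain R S))
          fun a 𝔭 => PrimarySupp a 𝔭)) ∧
    (∀ A : (chainTemperedFrobenioidR R S).category,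
      FrobenioidFacade.AutActionFactorsThrough ((chainTemperedFrobenioidR R S).base ⋙ cnstChain)
        (chainTemperedFrobenioidR R S).toElem A) ∧
    (chainTemperedFrobenioidR R S).Thm37_iv :=
  thm37_chainTemperedFrobenioidR_of_hrat R S (isRational_chain R S)

end Sec3Prop34CnstOfRlfRChainModel

end Literature.AnabelianGeometry.EtaleTheta

end
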